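import Mathlib
import Summits.KontsevichZagierPeriods.Zeta5Search.BrickDepthOneCell
import Summits.KontsevichZagierPeriods.Zeta5Search.BrickHarmonicShift
import Summits.KontsevichZagierPeriods.Zeta5Search.BrickDigitSideZero

/-!
# BrickStripDerivMain — CROSS-ROW LOCALITY of the strip derivative for the MAIN digits:
`w₁(k₀ + Kp; n₀ + Np) ≡ p·c_{k₀,A−1}(n₀) (mod p²)` when the digit `k₀` carries nothing (cell zeta5-irr)

HONEST FRAMING: systematic search; no irrationality claim unless certified. INSTRUMENT-tier arithmetic of the ζ(5)
census cell zeta5-irr (HOME `run/shared/lean/pub/zeta5-irr/`), filed by the engine seat zi-eng (g13). WHAT THIS IS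
NOT: nothing about ζ(5); no denominator saving; 0 nats/n; rung F-Z1 NOT moved. This is the main-digit case of the
strip-sum law (V) of `BrickLucasAssembly.lucas_of_blockLaws` (numerically the termwise law holds for every ° digit,
0 failures in 2 945 cells; the carry digits and the centre digit are the sequel files).

## The statement (`stripDeriv_main_local`)

`p` odd, `A` ≥ `2B`, `1 ≤ B`, row `n = n₀ + Np` of the kernel `ε = 1`, a MAIN digit `k₀ ≤ n₀` (`n₀ + k₀ < p`,
`2n₀ − k₀ < p`, `2k₀ ≠ n₀`), any block `K ≤ N`:
**`v(w₁(k₀ + Kp) − p·c_{k₀,A−1}(n₀)) ≤ exp(−2)`** (`w₁ = stripDeriv`, `c_{k₀,A−1}(n₀) = laurent A B 1 n₀ k₀ 1`).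

PROOF: by `BrickDepthOneCell.laurent_one_eq`, `w₁ = λ·(p·Φ₁(n,k) − Φ₀(N,K))` and `p·c_{k₀,A−1}(n₀) = c_{k₀,A}(n₀)·p·Φ₁(n₀,k₀)`
with `Φ_ε(n,k) = ε/(n/2−k) + (A+B)(H_k − H_{n−k}) + B(H_{2n−k} − H_{n+k})`; the four harmonic arguments of the cell
`(n,k)` have bottom digits `k₀, n₀−k₀, 2n₀−k₀, n₀+k₀` and top digits `K, N−K, 2N−K, N+K` (no carry), so
`BrickHarmonicShift.harmonic_shift` (`p·H_{x₀+Xp} ≡ H_X + p·H_{x₀} (mod p²)`) gives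
`p·Φ₁(n,k) − Φ₀(N,K) ≡ p·Φ₁(n₀,k₀) (mod p²)` (the centre terms differ by `p²(N/2−K)/unit`); finally
`λ ≡ c_{k₀,A}(n₀) (mod p)` (`BrickLambdaDigit.lambda_congr_circ`) and `p·Φ₁(n₀,k₀) ∈ pℤ_(p)`.
-/

namespace Summit.KontsevichZagierPeriods.Zeta5Search.BrickStripDerivMain

open Finset Nat WithZero
open Summit.KontsevichZagierPeriods.Zeta5Search.BrickTopCoefficient (cTop)
open Summit.KontsevichZagierPeriods.Zeta5Search.BrickLaurent (laurent)
open Summit.KontsevichZagierPeriods.Zeta5Search.BrickHarmonicBlocks (hsum)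
open Summit.KontsevichZagierPeriods.Zeta5Search.BrickLambda (cTop_zero_ne_zero padicValuation_two)
open Summit.KontsevichZagierPeriods.Zeta5Search.BrickLambdaCirc (padicValuation_centre_eq_one)
open Summit.KontsevichZagierPeriods.Zeta5Search.BrickLambdaDigit (lambda_congr_circ)
open Summit.KontsevichZagierPeriods.Zeta5Search.BrickResidueLawCirc (lambda_circ_le_one)
open Summit.KontsevichZagierPeriods.Zeta5Search.BrickDigitSide (le_exp_neg_one_of_lt_one)
open Summit.KontsevichZagierPeriods.Zeta5Search.BrickDigitSideZero (hsum_integral_of_lt)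
open Summit.KontsevichZagierPeriods.Zeta5Search.BrickDepthOneCell (laurent_one_eq)
open Summit.KontsevichZagierPeriods.Zeta5Search.BrickHarmonicShift (harmonic_shift)
open Summit.KontsevichZagierPeriods.Zeta5Search.BrickLucasAssembly (stripDeriv)

noncomputable section

variable {p : ℕ} [Fact p.Prime]

omit [Fact p.Prime] in
/-- A non-centre digit stays off the centre in every block: `2k₀ ≠ n₀`, `k₀ ≤ n₀ < p` `⇒ 2(k₀ + Kp) ≠ n₀ + Np`. -/
theorem two_mul_ne_of_digit {n₀ k₀ : ℕ} (hn₀ : n₀ < p) (hk₀ : k₀ ≤ n₀) (hc : 2 * k₀ ≠ n₀) (N K : ℕ) :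
    2 * (k₀ + K * p) ≠ n₀ + N * p := by
  intro h
  have hmod : (2 * k₀ + 2 * K * p) % p = (n₀ + N * p) % p := by rw [← h]; ring_nf
  rw [Nat.add_mul_mod_self_right, Nat.add_mul_mod_self_right, Nat.mod_eq_of_lt hn₀] at hmod
  by_cases h2 : 2 * k₀ < p
  · rw [Nat.mod_eq_of_lt h2] at hmod; exact hc hmod
  · have h3 : 2 * k₀ - p < p := by omega
    rw [show 2 * k₀ = 2 * k₀ - p + p by omega, Nat.add_mod_right, Nat.mod_eq_of_lt h3] at hmod
    omega

omit [Fact p.Prime] in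
/-- The centre offset of a non-centre digit is a unit: `¬ p ∣ (n₀ + Np) − 2(k₀ + Kp)` for `2k₀ ≠ n₀`, `k₀ ≤ n₀ < p`. -/
theorem not_dvd_centre_of_digit {n₀ k₀ : ℕ} (hn₀ : n₀ < p) (hk₀ : k₀ ≤ n₀) (hc : 2 * k₀ ≠ n₀) (N K : ℕ) :
    ¬ (p : ℤ) ∣ ((n₀ + N * p : ℕ) : ℤ) - 2 * ((k₀ + K * p : ℕ) : ℤ) := by
  intro h
  have h' : (p : ℤ) ∣ (n₀ : ℤ) - 2 * k₀ := by
    have e : ((n₀ + N * p : ℕ) : ℤ) - 2 * ((k₀ + K * p : ℕ) : ℤ) = ((n₀ : ℤ) - 2 * k₀) + p * ((N : ℤ) - 2 * K) := by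
      push_cast; ring
    rw [e] at h
    exact (dvd_add_left (dvd_mul_right _ _)).1 h
  have hz : (n₀ : ℤ) - 2 * k₀ = 0 := by
    refine Int.eq_zero_of_dvd_of_natAbs_lt_natAbs h' ?_
    rw [Int.natAbs_natCast]
    omega
  omega

section main

variable (hp2 : p ≠ 2) {A B N n₀ K k₀ : ℕ} (hAB : 2 * B ≤ A) (hB : 1 ≤ B) (hn₀ : n₀ < p) (hk₀ : k₀ ≤ n₀) (hK : K ≤ N)
  (h1 : n₀ + k₀ < p) (h2 : n₀ + (n₀ - k₀) < p) (hc : 2 * k₀ ≠ n₀)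
include hp2 hAB hB hn₀ hk₀ hK h1 h2 hc

/-- **CROSS-ROW LOCALITY OF THE STRIP DERIVATIVE, MAIN DIGITS**: for a digit `k₀ ≤ n₀` without carries
(`n₀ + k₀ < p`, `2n₀ − k₀ < p`) and off the centre (`2k₀ ≠ n₀`), every block `K ≤ N` of the row `n₀ + Np`
(kernel `ε = 1`) has `v(w₁(k₀ + Kp) − p·c_{k₀,A−1}(n₀)) ≤ exp(−2)`. -/
theorem stripDeriv_main_local :
    Rat.padicValuation p (stripDeriv A B 1 p n₀ N k₀ K - (p : ℚ) * laurent A B 1 n₀ k₀ 1) ≤ exp (-2 : ℤ) := by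
  have hp : p.Prime := Fact.out
  have hpQ : (p : ℚ) ≠ 0 := by exact_mod_cast hp.ne_zero
  have hpv : Rat.padicValuation p (p : ℚ) = exp (-1 : ℤ) := Rat.padicValuation_self p
  obtain ⟨M, rfl⟩ := Nat.exists_eq_add_of_le hK
  have hkn : k₀ + K * p ≤ n₀ + (K + M) * p := by nlinarith
  have hcen := two_mul_ne_of_digit hn₀ hk₀ hc (K + M) K
  -- the three cells in closed form
  have eL1 := laurent_one_eq hAB (ε := 1) le_rfl hkn (Or.inl hcen)
  have el1 := laurent_one_eq hAB (ε := 0) (Nat.zero_le 1) (Nat.le_add_right K M) (Or.inr rfl)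
  have eL0 := laurent_one_eq hAB (ε := 1) le_rfl hk₀ (Or.inl hc)
  -- subtraction-free digit bookkeeping of the four harmonic arguments
  have ek : k₀ + K * p = k₀ + K * p := rfl
  have enk : n₀ + (K + M) * p - (k₀ + K * p) = (n₀ - k₀) + M * p := by
    rw [add_mul]; omega
  have e2nk : 2 * (n₀ + (K + M) * p) - (k₀ + K * p) = (n₀ + (n₀ - k₀)) + (K + M + M) * p := by
    rw [add_mul, add_mul, add_mul]; omega
  have epk : n₀ + (K + M) * p + (k₀ + K * p) = (n₀ + k₀) + (K + M + K) * p := by ring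
  have eNK : K + M - K = M := by omega
  have e2NK : 2 * (K + M) - K = K + M + M := by omega
  have eNpK : K + M + K = K + M + K := rfl
  have en0 : n₀ - k₀ = n₀ - k₀ := rfl
  have e2n0 : 2 * n₀ - k₀ = n₀ + (n₀ - k₀) := by omega
  -- the multiplier
  set lam : ℚ := cTop A B 1 (n₀ + (K + M) * p) (k₀ + K * p) / cTop A B 0 (K + M) K with hlam
  have hlam_mul : lam * cTop A B 0 (K + M) K = cTop A B 1 (n₀ + (K + M) * p) (k₀ + K * p) :=
    div_mul_cancel₀ _ (cTop_zero_ne_zero (Nat.le_add_right K M) A B)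
  have hv_lam : Rat.padicValuation p lam ≤ 1 := lambda_circ_le_one hp2 rfl rfl hn₀ hk₀ (Nat.le_add_right K M) hlam_mul
  have hv_lamc : Rat.padicValuation p (lam - cTop A B 1 n₀ k₀) ≤ exp (-1 : ℤ) :=
    le_exp_neg_one_of_lt_one (lambda_congr_circ hp2 (A := A) (ε := 1) hB rfl rfl hn₀ hk₀ (Nat.le_add_right K M))
  -- the four harmonic shifts and the centre shift
  set Ψ : ℚ := (p : ℚ) * ((1 : ℕ) / (((n₀ + (K + M) * p : ℕ) : ℚ) / 2 - ((k₀ + K * p : ℕ) : ℚ)) +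
      ((A : ℚ) + B) * (hsum 1 (k₀ + K * p) - hsum 1 (n₀ + (K + M) * p - (k₀ + K * p))) +
      (B : ℚ) * (hsum 1 (2 * (n₀ + (K + M) * p) - (k₀ + K * p)) - hsum 1 (n₀ + (K + M) * p + (k₀ + K * p)))) -
    ((0 : ℕ) / (((K + M : ℕ) : ℚ) / 2 - (K : ℚ)) + ((A : ℚ) + B) * (hsum 1 K - hsum 1 (K + M - K)) +
      (B : ℚ) * (hsum 1 (2 * (K + M) - K) - hsum 1 (K + M + K))) with hΨ
  set Φ0 : ℚ := (1 : ℕ) / ((n₀ : ℚ) / 2 - k₀) + ((A : ℚ) + B) * (hsum 1 k₀ - hsum 1 (n₀ - k₀)) +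
      (B : ℚ) * (hsum 1 (2 * n₀ - k₀) - hsum 1 (n₀ + k₀)) with hΦ0
  have hw : stripDeriv A B 1 p n₀ (K + M) k₀ K = lam * Ψ := by
    have h0 := cTop_zero_ne_zero (Nat.le_add_right K M) A B
    rw [stripDeriv, eL1, el1, ← hlam_mul, mul_div_cancel_right₀ _ h0, div_eq_iff h0, hΨ]
    ring
  have hΨΦ : Rat.padicValuation p (Ψ - (p : ℚ) * Φ0) ≤ exp (-2 : ℤ) := by
    -- the centre shift
    have hc1 : Rat.padicValuation p ((((n₀ + (K + M) * p : ℕ) : ℚ)) / 2 - ((k₀ + K * p : ℕ) : ℚ)) = 1 :=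
      padicValuation_centre_eq_one hp2 (not_dvd_centre_of_digit hn₀ hk₀ hc (K + M) K)
    have hc0 : Rat.padicValuation p ((n₀ : ℚ) / 2 - k₀) = 1 := by
      have h := padicValuation_centre_eq_one (p := p) hp2 (not_dvd_centre_of_digit hn₀ hk₀ hc 0 0)
      simpa using h
    have hne1 : ((((n₀ + (K + M) * p : ℕ) : ℚ)) / 2 - ((k₀ + K * p : ℕ) : ℚ)) ≠ 0 := fun h => by
      rw [h, map_zero] at hc1; exact zero_ne_one hc1
    have hne0 : ((n₀ : ℚ) / 2 - k₀) ≠ 0 := fun h => by rw [h, map_zero] at hc0; exact zero_ne_one hc0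
    have hcentre : Rat.padicValuation p ((p : ℚ) * ((1 : ℕ) / ((((n₀ + (K + M) * p : ℕ) : ℚ)) / 2 -
        ((k₀ + K * p : ℕ) : ℚ))) - (p : ℚ) * ((1 : ℕ) / ((n₀ : ℚ) / 2 - k₀))) ≤ exp (-2 : ℤ) := by
      have hc01 : ((n₀ : ℚ) / 2 - k₀) - ((((n₀ + (K + M) * p : ℕ) : ℚ)) / 2 - ((k₀ + K * p : ℕ) : ℚ)) =
          -((p : ℚ) * (((((K + M : ℕ) : ℤ) - 2 * K : ℤ) : ℚ) / 2)) := by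
        push_cast; ring
      rw [show (p : ℚ) * ((1 : ℕ) / ((((n₀ + (K + M) * p : ℕ) : ℚ)) / 2 - ((k₀ + K * p : ℕ) : ℚ))) -
          (p : ℚ) * ((1 : ℕ) / ((n₀ : ℚ) / 2 - k₀)) =
          -((p : ℚ) * (p : ℚ) * (((((K + M : ℕ) : ℤ) - 2 * K : ℤ) : ℚ) / 2)) /
            (((((n₀ + (K + M) * p : ℕ) : ℚ)) / 2 - ((k₀ + K * p : ℕ) : ℚ)) * ((n₀ : ℚ) / 2 - k₀)) by
          rw [Nat.cast_one, one_div, one_div, ← mul_sub, inv_sub_inv hne1 hne0, hc01]; ring, map_div₀,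
        Valuation.map_neg]
      simp only [map_mul, map_div₀, hc1, hc0, hpv, padicValuation_two hp2, Rat.padicValuation_cast, mul_one, div_one]
      calc _ ≤ exp (-1 : ℤ) * exp (-1 : ℤ) * 1 := mul_le_mul' le_rfl (Int.padicValuation_le_one _ _)
        _ = _ := by rw [mul_one, ← exp_add]; norm_num
    -- the four harmonic shifts
    have hs1 := harmonic_shift hp2 (x₀ := k₀) (by omega) K
    have hs2 := harmonic_shift hp2 (x₀ := n₀ - k₀) (by omega) M
    have hs3 := harmonic_shift hp2 (x₀ := n₀ + (n₀ - k₀)) h2 (K + M + M)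
    have hs4 := harmonic_shift hp2 (x₀ := n₀ + k₀) h1 (K + M + K)
    have hAB1 : Rat.padicValuation p ((A : ℚ) + B) ≤ 1 := by
      rw [← Nat.cast_add]; exact Literature.NumberTheory.LFunctions.padicValuation_natCast_le_one _
    have hB1 : Rat.padicValuation p (B : ℚ) ≤ 1 := Literature.NumberTheory.LFunctions.padicValuation_natCast_le_one _
    rw [hΨ, hΦ0, enk, e2nk, epk, eNK, e2NK, e2n0, Nat.cast_zero, zero_div, zero_add,
      show ∀ (c₁ c₀ a₁ a₂ a₃ a₄ b₁ b₂ b₃ b₄ d₁ d₂ d₃ d₄ : ℚ),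
        (p : ℚ) * (c₁ + ((A : ℚ) + B) * (a₁ - a₂) + (B : ℚ) * (a₃ - a₄)) -
          (((A : ℚ) + B) * (b₁ - b₂) + (B : ℚ) * (b₃ - b₄)) -
          (p : ℚ) * (c₀ + ((A : ℚ) + B) * (d₁ - d₂) + (B : ℚ) * (d₃ - d₄)) =
        ((p : ℚ) * c₁ - (p : ℚ) * c₀) +
          ((A : ℚ) + B) * (((p : ℚ) * a₁ - b₁ - p * d₁) - ((p : ℚ) * a₂ - b₂ - p * d₂)) +
          (B : ℚ) * (((p : ℚ) * a₃ - b₃ - p * d₃) - ((p : ℚ) * a₄ - b₄ - p * d₄)) from fun _ _ _ _ _ _ _ _ _ _ _ _ _ _ => by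
        ring]
    refine (Valuation.map_add _ _ _).trans (max_le ((Valuation.map_add _ _ _).trans (max_le hcentre ?_)) ?_)
    · rw [map_mul]
      calc _ ≤ 1 * exp (-2 : ℤ) := mul_le_mul' hAB1 ((Valuation.map_sub _ _ _).trans (max_le hs1 hs2))
        _ = _ := one_mul _
    · rw [map_mul]
      calc _ ≤ 1 * exp (-2 : ℤ) := mul_le_mul' hB1 ((Valuation.map_sub _ _ _).trans (max_le hs3 hs4))
        _ = _ := one_mul _
  -- `p·Φ₁(n₀,k₀) ∈ pℤ_(p)`
  have hΦ0v : Rat.padicValuation p ((p : ℚ) * Φ0) ≤ exp (-1 : ℤ) := by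
    have hc0 : Rat.padicValuation p ((n₀ : ℚ) / 2 - k₀) = 1 := by
      have h := padicValuation_centre_eq_one (p := p) hp2 (not_dvd_centre_of_digit hn₀ hk₀ hc 0 0)
      simpa using h
    have hH : ∀ x, x < p → Rat.padicValuation p (hsum 1 x) ≤ 1 := fun x hx => hsum_integral_of_lt hx 1
    rw [map_mul, hpv, hΦ0]
    refine (mul_le_mul' le_rfl ((Valuation.map_add _ _ _).trans (max_le ((Valuation.map_add _ _ _).trans
      (max_le ?_ ?_)) ?_))).trans (by rw [mul_one])
    · rw [map_div₀, hc0, div_one, Nat.cast_one, map_one]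
    · rw [map_mul, ← Nat.cast_add]
      exact mul_le_one' (Literature.NumberTheory.LFunctions.padicValuation_natCast_le_one _)
        ((Valuation.map_sub _ _ _).trans (max_le (hH _ (by omega)) (hH _ (by omega))))
    · rw [map_mul]
      exact mul_le_one' (Literature.NumberTheory.LFunctions.padicValuation_natCast_le_one _)
        ((Valuation.map_sub _ _ _).trans (max_le (hH _ (by omega)) (hH _ (by omega))))
  -- assemble
  rw [hw, eL0, show lam * Ψ - (p : ℚ) * (cTop A B 1 n₀ k₀ * Φ0) =
      lam * (Ψ - (p : ℚ) * Φ0) + (lam - cTop A B 1 n₀ k₀) * ((p : ℚ) * Φ0) by ring]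
  refine (Valuation.map_add _ _ _).trans (max_le ?_ ?_)
  · rw [map_mul]
    calc _ ≤ 1 * exp (-2 : ℤ) := mul_le_mul' hv_lam hΨΦ
      _ = _ := one_mul _
  · rw [map_mul]
    calc _ ≤ exp (-1 : ℤ) * exp (-1 : ℤ) := mul_le_mul' hv_lamc hΦ0v
      _ = _ := by rw [← exp_add]; norm_num

end main

end

end Summit.KontsevichZagierPeriods.Zeta5Search.BrickStripDerivMain
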